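import Literature.AlgebraicTopology.Homotopy.SphereMapsGeneralPosition
import Literature.AlgebraicTopology.Homotopy.CubeSqueeze
import Literature.AlgebraicTopology.Homotopy.RelativeLoopCollar
import HarnessLib

/-!
# Homotopy excision for the hemisphere triad of `Sⁿ⁺¹` (Hatcher, Thm. 4.23, Case 1)

Topic `Literature/AlgebraicTopology/Homotopy`. Hatcher, *Algebraic Topology* (2002), §4.2,
Thm. 4.23 (homotopy excision: for a CW complex `X = A ∪ B`, `C = A ∩ B`, with `(A, C)`
`m`-connected and `(B, C)` `n`-connected, `πᵢ(A, C) → πᵢ(X, B)` is an isomorphism for `i < m + n`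
and a surjection for `i = m + n`), in the case used for the Freudenthal suspension theorem
(Cor. 4.24): `X = Sⁿ⁺¹`, `A = C₊` and `B = C₋` the closed hemispheres (each the equator `Sⁿ` with
one `(n+1)`-cell attached, so `m = n` and this is Hatcher's *Case 1*), `C = Sⁿ` the equator.
Following the printed proof of Case 1 (pp. 361–362) step by step — preliminary deformation into
general position (`SphereMapsGeneralPosition.lean`, smooth instead of piecewise linear), the Claim
and the excising homotopy (`CubeSqueeze.lean`), and the vertical isomorphisms of the commutative
square `πᵢ(A, C) ≈ πᵢ(X - q, X - q - p)`, `πᵢ(X, B) ≈ πᵢ(X, X - p)` realised by the deformation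
retractions of `HemisphereRetractions.lean` through the collar lemmas of `RelativeLoopCollar.lean`
— this file PROVES, for relative loops indexed by a finite type `N` (`|N| = i`):

* `HemisphereExcision.exists_homotopic_map_incl` — **surjectivity** for `i ≤ 2n`: every relative
  loop of `(Sⁿ⁺¹, C₋, a)` is homotopic, through such loops, to (the image of) a relative loop of
  `(C₊, Sⁿ, a)`;
* `HemisphereExcision.homotopic_const_of_map_incl` — **injectivity on the kernel** for
  `i + 1 ≤ 2n`: a relative loop of `(C₊, Sⁿ, a)` whose image in `(Sⁿ⁺¹, C₋, a)` is null-homotopic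
  is null-homotopic ("Since `Iⁱ × I` now plays the role of `Iⁱ`, the dimension `i` is replaced by
  `i + 1`", p. 362).

Only these two statements (all that the Freudenthal theorem in `Subsingleton` form needs) are
formalised; everything is proved, no named facts.

## References

* A. Hatcher, *Algebraic Topology*, CUP (2002), §4.2, Thm. 4.23 and its proof, Case 1
  (pp. 360–362); Cor. 4.24. [HatcherAT2002]
-/

noncomputable section

open Set Function Metric Topology unitInterval
open scoped Topology Topology.Homotopy
open Literature.AlgebraicTopology.SingularHomology.SphereComplement

namespace Literature.AlgebraicTopology.Homotopy

namespace HemisphereExcision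

open Hemi SphereGP CubeSqueeze RelGenLoop

/-- Local notation: `𝔼 n` is the model Euclidean space `EuclideanSpace ℝ (Fin n)`. -/
local notation "𝔼 " n:arg => EuclideanSpace ℝ (Fin n)

/-- Local notation: `𝕊 n` is the unit sphere in `EuclideanSpace ℝ (Fin (n + 1))`. -/
local notation "𝕊 " n:arg => (Metric.sphere (0 : EuclideanSpace ℝ (Fin (n + 1))) 1)

variable {n : ℕ}

/-! ### The triad: `A = C₊` as a space, the equator inside it, the inclusion -/

/-- The closed upper hemisphere `A = C₊` as a space. [cite: HatcherAT2002, §4.2 Cor. 4.24] -/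
abbrev Up (n : ℕ) : Type := ↥(capUp : Set (𝕊 (n + 1)))

/-- The equator `Sⁿ ⊆ C₊`, as a subset of the space `C₊`. [cite: HatcherAT2002, §4.2 Cor. 4.24] -/
def eqUp (n : ℕ) : Set (Up n) := {x | hgt x.1 = 0}

/-- The punctured hemisphere `C₊ - {p}` as a subset of `C₊`. [folklore] -/
def upMinus (p : 𝕊 (n + 1)) : Set (Up n) := {x | x.1 ≠ p}

/-- The inclusion `C₊ → Sⁿ⁺¹`. [folklore] -/
def incl (n : ℕ) : C(Up n, 𝕊 (n + 1)) := ⟨Subtype.val, continuous_subtype_val⟩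

/-- The inclusion maps the equator into `C₋`. [folklore] -/
theorem mapsTo_incl_eqUp : MapsTo (incl n) (eqUp n) (capLo : Set (𝕊 (n + 1))) :=
  fun _ hx => mem_capLo_iff.2 (le_of_eq hx)

/-- The inclusion maps `C₊ - {p}` into `Sⁿ⁺¹ - {p}`. [folklore] -/
theorem mapsTo_incl_upMinus (p : 𝕊 (n + 1)) : MapsTo (incl n) (upMinus p) ({p}ᶜ : Set (𝕊 (n + 1))) :=
  fun _ hx => hx

/-- The equator misses the open upper hemisphere. [folklore] -/
theorem eqUp_subset_upMinus {p : 𝕊 (n + 1)} (hp : 0 < hgt p) : eqUp n ⊆ upMinus p :=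
  fun x hx h => by
    have h0 : hgt x.1 = 0 := hx
    rw [h] at h0
    exact hp.ne' h0

/-- `C₋ ⊆ Sⁿ⁺¹ - {p}` for `h(p) > 0`. [folklore] -/
theorem capLo_subset_compl {p : 𝕊 (n + 1)} (hp : 0 < hgt p) :
    (capLo : Set (𝕊 (n + 1))) ⊆ ({p}ᶜ : Set (𝕊 (n + 1))) :=
  fun x hx h => by rw [mem_capLo_iff, h] at hx; exact not_lt.2 hx hp

/-! ### Building relative loops and homotopies from maps of cubes -/

section Builders

variable {N : Type*} {Y : Type*} [TopologicalSpace Y] {s : N} {D : Set Y} {b : D}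

variable (s) in
/-- A relative loop from a map of the cube with the two face conditions. [folklore] -/
def mkLoop (g : C((N → I), Y)) (h0 : ∀ y : N → I, y s = 0 → g y ∈ D)
    (hJ : ∀ y ∈ jBoundary s, g y = (b : Y)) : RelGenLoop s D b := ⟨g, h0, hJ⟩

/-- Values of `mkLoop`. [folklore] -/
@[simp] theorem mkLoop_apply (g : C((N → I), Y)) (h0 : ∀ y : N → I, y s = 0 → g y ∈ D)
    (hJ : ∀ y ∈ jBoundary s, g y = (b : Y)) (y : N → I) : (mkLoop s g h0 hJ) y = g y := rfl

/-- A homotopy of relative loops from a homotopy of the cube maps all of whose stages satisfy the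
face conditions. [folklore] -/
theorem homotopic_of_stages {g₀ g₁ : RelGenLoop s D b} (K : C(I × (N → I), Y))
    (hK0 : ∀ y, K (0, y) = g₀ y) (hK1 : ∀ y, K (1, y) = g₁ y)
    (hD : ∀ (t : I) (y : N → I), y s = 0 → K (t, y) ∈ D)
    (hJ : ∀ (t : I), ∀ y ∈ jBoundary s, K (t, y) = (b : Y)) : Homotopic g₀ g₁ :=
  ⟨{ toFun := K
     continuous_toFun := K.continuous
     map_zero_left := hK0
     map_one_left := hK1
     prop' := fun t => ⟨hD t, hJ t⟩ }⟩

/-- Two relative loops with the same values are homotopic (they are equal). [folklore] -/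
theorem homotopic_of_eq {g₀ g₁ : RelGenLoop s D b} (h : ∀ y, g₀ y = g₁ y) : Homotopic g₀ g₁ := by
  have : g₀ = g₁ := RelGenLoop.ext _ _ h
  rw [this]

end Builders

/-- Values of the inclusion. [folklore] -/
@[simp] theorem incl_apply (x : Up n) : incl n x = x.1 := rfl


/-! ### The deformations, packaged for the collar lemmas -/

/-- `ρLo q` never produces the point `p` of the open upper hemisphere from a point other than `p`
(it fixes `C₊` and keeps heights `≤ 0` nonpositive). [folklore] -/
theorem ρLo_ne_of_ne {p q : 𝕊 (n + 1)} (hp : 0 < hgt p) (hq : hgt q < 0) (t : I) {x : 𝕊 (n + 1)}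
    (hx : x ≠ p) : ρLo q (t, x) ≠ p := by
  obtain ⟨-, -, -, -, hρC, hρlo⟩ := ρLo_spec hq
  rcases le_or_gt 0 (hgt x) with h | h
  · rw [hρC t x (mem_capUp_iff.2 h)]; exact hx
  · intro h'
    have := hρlo t x h.le
    rw [h'] at this; linarith

/-- The deformation `ρUp p` restricted to `C₊` (which it preserves), as a self-map of
`[0, 1] × C₊`. [folklore] -/
def ρA (p : 𝕊 (n + 1)) (hp : 0 < hgt p) (z : I × Up n) : Up n :=
  ⟨ρUp p (z.1, z.2.1), mem_capUp_iff.2 ((ρUp_spec hp).2.2.2.2.2 z.1 z.2.1 (mem_capUp_iff.1 z.2.2))⟩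

/-- **`C₊ - {p}` deforms onto the equator inside `C₊`**: the hypotheses of the collar lemmas for
`C = Sⁿ ⊆ D = C₊ - {p}` in `Y = C₊` (Hatcher 2002, Cor. 4.24: `(C₊X, X)`; p. 362).
[cite: HatcherAT2002, §4.2, proof of Thm. 4.23 (p. 362)] -/
theorem ρA_collar {p : 𝕊 (n + 1)} (hp : 0 < hgt p) :
    ContinuousOn (ρA p hp) {z | z.2 ∈ upMinus p} ∧
    (∀ (t : I) (x : Up n), x ∈ upMinus p → ρA p hp (t, x) ∈ upMinus p) ∧
    (∀ x : Up n, x ∈ upMinus p → ρA p hp (0, x) = x) ∧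
    (∀ x : Up n, x ∈ upMinus p → ρA p hp (1, x) ∈ eqUp n) ∧
    (∀ (t : I) (x : Up n), x ∈ eqUp n → ρA p hp (t, x) = x) := by
  obtain ⟨-, hσD, hσ0, hσ1, hσC, hσup⟩ := ρUp_spec hp
  refine ⟨?_, fun t x hx => hσD t x.1 hx, fun x _ => Subtype.ext (hσ0 x.1), fun x hx =>
    le_antisymm (mem_capLo_iff.1 (hσ1 x.1 hx)) (hσup 1 x.1 (mem_capUp_iff.1 x.2)), fun t x hx =>
    Subtype.ext (hσC t x.1 (mem_capLo_iff.2 (le_of_eq hx)))⟩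
  rw [Topology.IsInducing.subtypeVal.continuousOn_iff]
  show ContinuousOn (fun z : I × Up n => deformUp p ((z.1 : I) : ℝ) (z.2 : 𝕊 (n + 1))) {z | z.2 ∈ upMinus p}
  exact continuousOn_deformUp hp (continuous_subtype_val.comp continuous_fst).continuousOn
    (continuous_subtype_val.comp continuous_snd).continuousOn fun z hz => hz

/-- **`Sⁿ⁺¹ - {p}` deforms onto `C₋`**: the hypotheses of the collar lemmas for
`C = C₋ ⊆ D = Sⁿ⁺¹ - {p}` in `Y = Sⁿ⁺¹` (Hatcher 2002, p. 362: "`X - P` deformation retracts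
onto `B`"). [cite: HatcherAT2002, §4.2, proof of Thm. 4.23 (p. 362)] -/
theorem ρUp_collar {p : 𝕊 (n + 1)} (hp : 0 < hgt p) :
    ContinuousOn (ρUp p) {z | z.2 ∈ ({p}ᶜ : Set (𝕊 (n + 1)))} ∧
    (∀ (t : I) (x : 𝕊 (n + 1)), x ∈ ({p}ᶜ : Set (𝕊 (n + 1))) → ρUp p (t, x) ∈ ({p}ᶜ : Set (𝕊 (n + 1)))) ∧
    (∀ x : 𝕊 (n + 1), x ∈ ({p}ᶜ : Set (𝕊 (n + 1))) → ρUp p (0, x) = x) ∧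
    (∀ x : 𝕊 (n + 1), x ∈ ({p}ᶜ : Set (𝕊 (n + 1))) → ρUp p (1, x) ∈ (capLo : Set (𝕊 (n + 1)))) ∧
    (∀ (t : I) (x : 𝕊 (n + 1)), x ∈ (capLo : Set (𝕊 (n + 1))) → ρUp p (t, x) = x) := by
  obtain ⟨hσc, hσD, hσ0, hσ1, hσC, -⟩ := ρUp_spec hp
  exact ⟨hσc, hσD, fun x _ => hσ0 x, hσ1, hσC⟩

/-! ### Surjectivity: `π(C₊, Sⁿ) → π(Sⁿ⁺¹, C₋)` hits every class (`|N| ≤ 2n`) -/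

/-- **Homotopy excision for the hemisphere triad, surjectivity** (Hatcher 2002, Thm. 4.23 for
`X = Sⁿ⁺¹ = C₊ ∪ C₋`, Case 1 with `m = n`, `i = |N| ≤ m + n`): every relative loop `F` of
`(Sⁿ⁺¹, C₋, a)` (`a` on the equator) is homotopic through such loops to the image of a relative
loop of `(C₊, Sⁿ, a)`. Proof as printed (pp. 361–362): general position
(`SphereGP.exists_generalPosition`) gives `p ∈ C₊°`, `q ∈ C₋°` with `F⁻¹(p)` off the shadow of
`F⁻¹(q)`; the excising homotopy (`CubeSqueeze.exists_squeeze`) moves `F` inside `(X, X - p)` to a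
loop of `(X - q, X - q - p)`; the deformation of `X - q` onto `C₊` (`Hemi.ρLo`) and of `C₊ - p`
onto the equator (`Hemi.ρUp`, collar lemma) turn it into a loop of `(C₊, Sⁿ)`; and two loops of
`(X, C₋)` homotopic in `(X, X - p)` are homotopic in `(X, C₋)` (`X - p` deforms onto `C₋`, collar
lemma). [cite: HatcherAT2002, §4.2, Thm. 4.23, proof of Case 1 (pp. 361–362)] -/
theorem exists_homotopic_map_incl {N : Type*} [Fintype N] [DecidableEq N]
    (hN : Fintype.card N ≤ 2 * n) (s : N) (a : eqUp n)
    (F : RelGenLoop s (capLo : Set (𝕊 (n + 1))) ⟨incl n (a : Up n), mapsTo_incl_eqUp a.2⟩) :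
    ∃ f : RelGenLoop s (eqUp n) a, Homotopic F (RelGenLoop.map (incl n) mapsTo_incl_eqUp f) := by
  let base : (capLo : Set (𝕊 (n + 1))) := ⟨incl n (a : Up n), mapsTo_incl_eqUp a.2⟩
  have ha0 : hgt ((a : Up n) : 𝕊 (n + 1)) = 0 := a.2
  have hbase0 : hgt (base : 𝕊 (n + 1)) = 0 := ha0
  -- Step 1: general position
  obtain ⟨H, p, q, hp, hq, hH0, hband, hN34, hS34, hdisj⟩ :=
    exists_generalPosition hN s (F : C((N → I), 𝕊 (n + 1)))
  simp only [RelGenLoop.coe_apply] at hH0 hband hN34 hS34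
  have hbasep : (base : 𝕊 (n + 1)) ≠ p := fun h => by
    have := hbase0; rw [h] at this; exact hp.ne' this
  have hstage_lo : ∀ (t : I) (y : N → I), y s = 0 → H (t, y) ∈ (capLo : Set (𝕊 (n + 1))) := by
    intro t y hy
    have hFy : hgt (F y) ≤ 0 := mem_capLo_iff.1 (apply_mem F hy)
    rcases lt_or_ge (hgt (F y)) (-(3 / 4)) with h | h
    · exact mem_capLo_iff.2 (by have := hS34 t y h; linarith)
    · rw [hband t y h (by linarith)]; exact mem_capLo_iff.2 hFy
  have hstage_J : ∀ (t : I), ∀ y ∈ jBoundary s, H (t, y) = (base : 𝕊 (n + 1)) := by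
    intro t y hy
    have hFy : F y = (base : 𝕊 (n + 1)) := apply_of_mem_jBoundary F hy
    rw [hband t y (by rw [hFy, hbase0]; norm_num) (by rw [hFy, hbase0]; norm_num), hFy]
  let F' : C((N → I), 𝕊 (n + 1)) :=
    ⟨fun y => H (1, y), H.continuous.comp (continuous_const.prodMk continuous_id)⟩
  have hF'J : ∀ y ∈ jBoundary s, F' y = (base : 𝕊 (n + 1)) := fun y hy => hstage_J 1 y hy
  have hF'lo : ∀ y : N → I, y s = 0 → F' y ∈ (capLo : Set (𝕊 (n + 1))) := fun y hy => hstage_lo 1 y hy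
  let F'ℓ : RelGenLoop s (capLo : Set (𝕊 (n + 1))) base := mkLoop s F' hF'lo hF'J
  have h1 : Homotopic F F'ℓ := homotopic_of_stages H hH0 (fun y => rfl) hstage_lo hstage_J
  -- Step 2: the excising homotopy
  have hq_top : ∀ y : N → I, y s = 1 → F' y ≠ q := fun y hy h => by
    have h' := congrArg hgt ((hF'J y ((mem_jBoundary).2 (Or.inl hy))).symm.trans h)
    rw [hbase0] at h'; linarith
  have hq_walls : ∀ y : N → I, y ∈ walls s → F' y ≠ q := fun y hy h => by
    have h' := congrArg hgt ((hF'J y ((mem_jBoundary).2 (Or.inr hy))).symm.trans h)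
    rw [hbase0] at h'; linarith
  have hp_floor : ∀ y : N → I, y s = 0 → F' y ≠ p := fun y hy h => by
    have h' := mem_capLo_iff.1 (hF'lo y hy); rw [h] at h'; linarith
  obtain ⟨G, hG0, hGwalls, hGtop, hGfloor, hG1q, -⟩ :=
    exists_squeeze s F' p q hq_top hq_walls hp_floor hdisj
  have hGJ : ∀ (t : I), ∀ y ∈ jBoundary s, G (t, y) = (base : 𝕊 (n + 1)) := by
    intro t y hy
    rcases (mem_jBoundary).1 hy with htop | hw
    · rw [hGtop t y htop]; exact hF'J y hy
    · rw [hGwalls t y hw]; exact hF'J y hy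
  let D : Set (𝕊 (n + 1)) := {p}ᶜ
  have hcD : (capLo : Set (𝕊 (n + 1))) ⊆ D := capLo_subset_compl hp
  let F'' : C((N → I), 𝕊 (n + 1)) :=
    ⟨fun y => G (1, y), G.continuous.comp (continuous_const.prodMk continuous_id)⟩
  have hF''q : ∀ y, F'' y ≠ q := hG1q
  have hF''J : ∀ y ∈ jBoundary s, F'' y = (base : 𝕊 (n + 1)) := fun y hy => hGJ 1 y hy
  have hF''floor : ∀ y : N → I, y s = 0 → F'' y ∈ D := fun y hy => hGfloor 1 y hy
  let F''ℓ : RelGenLoop s D ⟨base, hcD base.2⟩ := mkLoop s F'' hF''floor hF''J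
  have h2 : Homotopic (widen hcD F'ℓ) F''ℓ :=
    homotopic_of_stages G hG0 (fun y => rfl) (fun t y hy => hGfloor t y hy) hGJ
  -- Step 3: deform `X - q` onto `C₊`
  obtain ⟨hρc, -, hρ0, hρ1, hρC, -⟩ := ρLo_spec hq
  have hρne : ∀ (t : I) (x : 𝕊 (n + 1)), x ≠ p → ρLo q (t, x) ≠ p := fun t x hx =>
    ρLo_ne_of_ne hp hq t hx
  have hKc : Continuous fun z : I × (N → I) => ρLo q (z.1, F'' z.2) := by
    rw [← continuousOn_univ]
    show ContinuousOn (fun z : I × (N → I) => deformLo q ((z.1 : I) : ℝ) (F'' z.2)) univ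
    exact continuousOn_deformLo hq (continuous_subtype_val.comp continuous_fst).continuousOn
      (F''.continuous.comp continuous_snd).continuousOn fun z _ => hF''q z.2
  let K : C(I × (N → I), 𝕊 (n + 1)) := ⟨fun z => ρLo q (z.1, F'' z.2), hKc⟩
  have hf₀c : Continuous fun y : N → I => ρLo q (1, F'' y) := by
    rw [← continuousOn_univ]
    show ContinuousOn (fun y : N → I => deformLo q ((1 : I) : ℝ) (F'' y)) univ
    exact continuousOn_deformLo hq continuousOn_const F''.continuous.continuousOn fun y _ => hF''q y
  let f₀ : C((N → I), 𝕊 (n + 1)) := ⟨fun y => ρLo q (1, F'' y), hf₀c⟩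
  have hf₀up : ∀ y, f₀ y ∈ (capUp : Set (𝕊 (n + 1))) := fun y => hρ1 _ (hF''q y)
  have hf₀J : ∀ y ∈ jBoundary s, f₀ y = (base : 𝕊 (n + 1)) := fun y hy => by
    show ρLo q (1, F'' y) = base
    rw [hF''J y hy]; exact hρC 1 _ (mem_capUp_iff.2 hbase0.ge)
  have hf₀floor : ∀ y : N → I, y s = 0 → f₀ y ∈ D := fun y hy => hρne 1 _ (hGfloor 1 y hy)
  let f₀ℓ : RelGenLoop s D ⟨base, hcD base.2⟩ := mkLoop s f₀ hf₀floor hf₀J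
  have h3 : Homotopic F''ℓ f₀ℓ :=
    homotopic_of_stages K (fun y => hρ0 _) (fun y => rfl) (fun t y hy => hρne t _ (hGfloor 1 y hy))
      fun t y hy => by
        show ρLo q (t, F'' y) = base
        rw [hF''J y hy]; exact hρC t _ (mem_capUp_iff.2 hbase0.ge)
  -- Step 4: push `C₊ - p` down onto the equator inside `C₊`
  let f₀A : C((N → I), Up n) := ⟨fun y => ⟨f₀ y, hf₀up y⟩, hf₀c.subtype_mk _⟩
  have haU : (a : Up n) ∈ upMinus p := eqUp_subset_upMinus hp a.2
  let f₀Aℓ : RelGenLoop s (upMinus p) ⟨(a : Up n), haU⟩ :=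
    mkLoop s f₀A (fun y hy => hf₀floor y hy) fun y hy => Subtype.ext (hf₀J y hy)
  obtain ⟨hAc, hAD, hA0, hA1, hAC⟩ := ρA_collar (n := n) hp
  obtain ⟨f, hf⟩ := RelGenLoop.exists_homotopic_widen s hAc hAD hA0 hA1 hAC (eqUp_subset_upMinus hp) a f₀Aℓ
  -- Step 5: back in `X`, inside `(X, X - p)`, then down to `(X, C₋)`
  have h4 : Homotopic (RelGenLoop.map (incl n) (mapsTo_incl_upMinus p) f₀Aℓ)
      (RelGenLoop.map (incl n) (mapsTo_incl_upMinus p) (widen (eqUp_subset_upMinus hp) f)) :=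
    homotopic_map _ _ hf
  have h34 : Homotopic f₀ℓ (RelGenLoop.map (incl n) (mapsTo_incl_upMinus p) f₀Aℓ) :=
    homotopic_of_eq fun y => rfl
  have h5 : Homotopic (RelGenLoop.map (incl n) (mapsTo_incl_upMinus p) (widen (eqUp_subset_upMinus hp) f))
      (widen hcD (RelGenLoop.map (incl n) mapsTo_incl_eqUp f)) :=
    homotopic_of_eq fun y => rfl
  have hchain : Homotopic (widen hcD F) (widen hcD (RelGenLoop.map (incl n) mapsTo_incl_eqUp f)) :=
    (((((homotopic_widen hcD h1).trans h2).trans h3).trans h34).trans h4).trans h5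
  obtain ⟨hσc, hσD, hσ0, hσ1, hσC⟩ := ρUp_collar (n := n) hp
  exact ⟨f, RelGenLoop.homotopic_of_homotopic_widen s hσc hσD hσ0 hσ1 hσC hcD base hchain⟩

/-! ### Injectivity on the kernel: `π(C₊, Sⁿ) → π(Sⁿ⁺¹, C₋)` (`|N| + 1 ≤ 2n`) -/

section Injectivity

variable {N : Type*}

/-- Inserting the homotopy parameter as the extra coordinate `none` of the cube `I^{Option N}`
("`Iⁱ × I` now plays the role of `Iⁱ`", Hatcher p. 362). [cite: HatcherAT2002, §4.2 p. 362] -/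
def enc (τ : I) (y : N → I) : Option N → I := fun o => o.elim τ y

/-- `enc` on the new coordinate. [folklore] -/
@[simp] theorem enc_none (τ : I) (y : N → I) : enc τ y none = τ := rfl

/-- `enc` on the old coordinates. [folklore] -/
@[simp] theorem enc_some (τ : I) (y : N → I) (j : N) : enc τ y (some j) = y j := rfl

/-- `enc` is jointly continuous. [folklore] -/
theorem continuous_enc : Continuous fun z : I × (N → I) => enc z.1 z.2 := by
  refine continuous_pi fun o => ?_
  cases o with
  | none => exact continuous_fst
  | some j => exact (continuous_apply j).comp continuous_snd

/-- Reading a map of `I × Iᴺ` as a map of the cube `I^{Option N}`. [folklore] -/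
def dec (w : Option N → I) : I × (N → I) := (w none, fun j => w (some j))

/-- `dec` is continuous. [folklore] -/
theorem continuous_dec : Continuous (dec : (Option N → I) → I × (N → I)) :=
  (continuous_apply none).prodMk (continuous_pi fun j => continuous_apply (some j))

/-- `dec ∘ enc = id`. [folklore] -/
@[simp] theorem dec_enc (τ : I) (y : N → I) : dec (enc τ y) = (τ, y) := rfl

/-- **Homotopy excision for the hemisphere triad, injectivity on the kernel** (Hatcher 2002,
Thm. 4.23 for `X = Sⁿ⁺¹ = C₊ ∪ C₋`, Case 1 with `m = n`, `i = |N|`, `i + 1 ≤ m + n`): a relative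
loop `f` of `(C₊, Sⁿ, a)` whose image in `(Sⁿ⁺¹, C₋, a)` is homotopic to the constant loop is itself
homotopic to the constant loop. Proof as printed (p. 362, "For injectivity … the argument is very
similar"): the null-homotopy `F : Iⁱ × I → X` is put in general position
(`SphereGP.exists_generalPosition` on the cube `I^{Option N}`), the region under the graph is
excised (`CubeSqueeze.exists_squeeze`), the result is deformed into `C₊` along `X - q ↝ C₊`
(`Hemi.ρLo`), giving a homotopy from `f` to the constant through loops of `(C₊, C₊ - p)`, and the
collar lemma for `C₊ - p ↝ Sⁿ` finishes. [cite: HatcherAT2002, §4.2, Thm. 4.23, proof of Case 1 (p. 362)] -/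
theorem homotopic_const_of_map_incl [Fintype N] [DecidableEq N]
    (hN : Fintype.card N + 1 ≤ 2 * n) (s : N) (a : eqUp n) (f : RelGenLoop s (eqUp n) a)
    (h : Homotopic (RelGenLoop.map (incl n) mapsTo_incl_eqUp f)
      (RelGenLoop.const s (capLo : Set (𝕊 (n + 1))) ⟨incl n (a : Up n), mapsTo_incl_eqUp a.2⟩)) :
    Homotopic f (RelGenLoop.const s (eqUp n) a) := by
  let base : (capLo : Set (𝕊 (n + 1))) := ⟨incl n (a : Up n), mapsTo_incl_eqUp a.2⟩
  have hbase0 : hgt (base : 𝕊 (n + 1)) = 0 := a.2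
  obtain ⟨Hh⟩ := h
  -- the null-homotopy as a map of the cube `I^{Option N}`
  let Hc : C((Option N → I), 𝕊 (n + 1)) := ⟨fun w => Hh (dec w), Hh.continuous.comp continuous_dec⟩
  have hHc0 : ∀ y : N → I, Hc (enc 0 y) = ((f y : Up n) : 𝕊 (n + 1)) := fun y => Hh.apply_zero y
  have hHc1 : ∀ y : N → I, Hc (enc 1 y) = (base : 𝕊 (n + 1)) := fun y => Hh.apply_one y
  have hHcfl : ∀ w : Option N → I, w (some s) = 0 → Hc w ∈ (capLo : Set (𝕊 (n + 1))) :=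
    fun w hw => (Hh.prop' (w none)).1 (fun j => w (some j)) hw
  have hHcJ : ∀ w : Option N → I, (fun j => w (some j)) ∈ jBoundary s → Hc w = (base : 𝕊 (n + 1)) :=
    fun w hw => (Hh.prop' (w none)).2 _ hw
  -- Step 1: general position on the big cube
  have hcard : Fintype.card (Option N) ≤ 2 * n := by rw [Fintype.card_option]; exact hN
  obtain ⟨H₂, p, q, hp, hq, hH0, hband, hN34, hS34, hdisj⟩ := exists_generalPosition hcard (some s) Hc
  have keepUp : ∀ (t : I) (w : Option N → I), Hc w ∈ (capUp : Set (𝕊 (n + 1))) →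
      H₂ (t, w) ∈ (capUp : Set (𝕊 (n + 1))) := by
    intro t w hw
    have h0 := mem_capUp_iff.1 hw
    rcases le_or_gt (hgt (Hc w)) (3 / 4) with h | h
    · rw [hband t w (by linarith) h]; exact hw
    · exact mem_capUp_iff.2 (by have := hN34 t w h; linarith)
  have keepLo : ∀ (t : I) (w : Option N → I), Hc w ∈ (capLo : Set (𝕊 (n + 1))) →
      H₂ (t, w) ∈ (capLo : Set (𝕊 (n + 1))) := by
    intro t w hw
    have h0 := mem_capLo_iff.1 hw
    rcases lt_or_ge (hgt (Hc w)) (-(3 / 4)) with h | h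
    · exact mem_capLo_iff.2 (by have := hS34 t w h; linarith)
    · rw [hband t w h (by linarith)]; exact hw
  have keepEq : ∀ (t : I) (w : Option N → I), hgt (Hc w) = 0 → H₂ (t, w) = Hc w :=
    fun t w hw => hband t w (by rw [hw]; norm_num) (by rw [hw]; norm_num)
  have keepBase : ∀ (t : I) (w : Option N → I), Hc w = (base : 𝕊 (n + 1)) →
      H₂ (t, w) = (base : 𝕊 (n + 1)) := fun t w hw => by
    rw [keepEq t w (by rw [hw]; exact hbase0), hw]
  have hbasep : (base : 𝕊 (n + 1)) ≠ p := fun h => by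
    have := hbase0; rw [h] at this; exact hp.ne' this
  -- the deformed `f`, read on the face `τ = 0` at time `1`
  have hencc : ∀ τ : I, Continuous fun y : N → I => enc τ y := fun τ =>
    continuous_enc.comp (continuous_const.prodMk continuous_id)
  have hf'up : ∀ y : N → I, H₂ (1, enc 0 y) ∈ (capUp : Set (𝕊 (n + 1))) := fun y =>
    keepUp 1 _ (by rw [hHc0]; exact (f y).2)
  let f'A : C((N → I), Up n) :=
    ⟨fun y => ⟨H₂ (1, enc 0 y), hf'up y⟩, (H₂.continuous.comp (continuous_const.prodMk (hencc 0))).subtype_mk _⟩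
  have hf'fl : ∀ y : N → I, y s = 0 → f'A y ∈ eqUp n := by
    intro y hy
    have h0 : hgt (Hc (enc 0 y)) = 0 := by rw [hHc0]; exact apply_mem f hy
    show hgt (H₂ (1, enc 0 y)) = 0
    rw [keepEq 1 _ h0]; exact h0
  have hf'J : ∀ y ∈ jBoundary s, f'A y = (a : Up n) := by
    intro y hy
    apply Subtype.ext
    show H₂ (1, enc 0 y) = (base : 𝕊 (n + 1))
    exact keepBase 1 _ (by rw [hHc0, apply_of_mem_jBoundary f hy]; rfl)
  let f'ℓ : RelGenLoop s (eqUp n) a := mkLoop s f'A hf'fl hf'J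
  have hff' : Homotopic f f'ℓ := by
    have hK₁c : Continuous fun z : I × (N → I) => H₂ (z.1, enc 0 z.2) :=
      H₂.continuous.comp (continuous_fst.prodMk ((hencc 0).comp continuous_snd))
    have hK₁up : ∀ z : I × (N → I), H₂ (z.1, enc 0 z.2) ∈ (capUp : Set (𝕊 (n + 1))) := fun z =>
      keepUp z.1 _ (by rw [hHc0]; exact (f z.2).2)
    refine homotopic_of_stages ⟨fun z => ⟨H₂ (z.1, enc 0 z.2), hK₁up z⟩, hK₁c.subtype_mk _⟩
      (fun y => Subtype.ext ?_) (fun y => rfl) (fun t y hy => ?_) (fun t y hy => Subtype.ext ?_)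
    · show H₂ (0, enc 0 y) = ((f y : Up n) : 𝕊 (n + 1)); rw [hH0, hHc0]
    · have h0 : hgt (Hc (enc 0 y)) = 0 := by rw [hHc0]; exact apply_mem f hy
      show hgt (H₂ (t, enc 0 y)) = 0
      rw [keepEq t _ h0]; exact h0
    · show H₂ (t, enc 0 y) = ((a : Up n) : 𝕊 (n + 1))
      exact keepBase t _ (by rw [hHc0, apply_of_mem_jBoundary f hy]; rfl)
  -- Step 2: excise the region under the graph
  let Hc' : C((Option N → I), 𝕊 (n + 1)) :=
    ⟨fun w => H₂ (1, w), H₂.continuous.comp (continuous_const.prodMk continuous_id)⟩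
  have hq_top : ∀ w : Option N → I, w (some s) = 1 → Hc' w ≠ q := fun w hw h => by
    have h1 : Hc' w = (base : 𝕊 (n + 1)) := keepBase 1 w (hHcJ w ((mem_jBoundary).2 (Or.inl hw)))
    have h' := congrArg hgt (h1.symm.trans h)
    rw [hbase0] at h'; linarith
  have hq_walls : ∀ w : Option N → I, w ∈ walls (some s) → Hc' w ≠ q := by
    rintro w ⟨o, ho, hw⟩ h
    cases o with
    | none =>
      rcases hw with hw | hw
      · -- the face `τ = 0`: values in `C₊`
        have hup : Hc' w ∈ (capUp : Set (𝕊 (n + 1))) := by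
          refine keepUp 1 w ?_
          have : w = enc 0 (fun j => w (some j)) := by
            funext o; cases o with
            | none => exact hw
            | some j => rfl
          rw [this, hHc0]; exact (f _).2
        have h' := mem_capUp_iff.1 hup
        rw [h] at h'; linarith
      · -- the face `τ = 1`: the constant `a`
        have h1 : Hc' w = (base : 𝕊 (n + 1)) := by
          refine keepBase 1 w ?_
          have : w = enc 1 (fun j => w (some j)) := by
            funext o; cases o with
            | none => exact hw
            | some j => rfl
          rw [this, hHc1]
        have h' := congrArg hgt (h1.symm.trans h)
        rw [hbase0] at h'; linarith
    | some j =>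
      have hj : j ≠ s := fun hjs => ho (by rw [hjs])
      have h1 : Hc' w = (base : 𝕊 (n + 1)) :=
        keepBase 1 w (hHcJ w ((mem_jBoundary).2 (Or.inr ⟨j, hj, hw⟩)))
      have h' := congrArg hgt (h1.symm.trans h)
      rw [hbase0] at h'; linarith
  have hp_floor : ∀ w : Option N → I, w (some s) = 0 → Hc' w ≠ p := fun w hw h => by
    have h' := mem_capLo_iff.1 (keepLo 1 w (hHcfl w hw))
    change hgt (Hc' w) ≤ 0 at h'
    rw [h] at h'; linarith
  obtain ⟨Gq, hG0, hGwalls, hGtop, hGfloor, hG1q, -⟩ :=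
    exists_squeeze (some s) Hc' p q hq_top hq_walls hp_floor hdisj
  let Hc'' : C((Option N → I), 𝕊 (n + 1)) :=
    ⟨fun w => Gq (1, w), Gq.continuous.comp (continuous_const.prodMk continuous_id)⟩
  have hnone_wall : ∀ (τ : I) (y : N → I), τ = 0 ∨ τ = 1 → Hc'' (enc τ y) = Hc' (enc τ y) :=
    fun τ y hτ => hGwalls 1 _ ⟨none, Option.some_ne_none s |>.symm, hτ⟩
  have hHc''q : ∀ w, Hc'' w ≠ q := hG1q
  have hHc''J : ∀ (τ : I), ∀ y ∈ jBoundary s, Hc'' (enc τ y) = (base : 𝕊 (n + 1)) := by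
    intro τ y hy
    rcases (mem_jBoundary).1 hy with htop | ⟨j, hj, hw⟩
    · show Gq (1, enc τ y) = base
      rw [hGtop 1 _ (by simpa using htop)]
      exact keepBase 1 _ (hHcJ _ hy)
    · show Gq (1, enc τ y) = base
      rw [hGwalls 1 _ ⟨some j, fun h => hj (Option.some_injective _ h), by simpa using hw⟩]
      exact keepBase 1 _ (hHcJ _ hy)
  -- Step 3: deform `X - q` onto `C₊`; a homotopy from `f'` to the constant inside `(C₊, C₊ - p)`
  obtain ⟨-, -, -, hρ1, hρC, -⟩ := ρLo_spec hq
  have hK₂c : Continuous fun z : I × (N → I) => ρLo q (1, Hc'' (enc z.1 z.2)) := by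
    rw [← continuousOn_univ]
    show ContinuousOn (fun z : I × (N → I) => deformLo q ((1 : I) : ℝ) (Hc'' (enc z.1 z.2))) univ
    exact continuousOn_deformLo hq continuousOn_const (Hc''.continuous.comp continuous_enc).continuousOn
      fun z _ => hHc''q _
  have hK₂up : ∀ z : I × (N → I), ρLo q (1, Hc'' (enc z.1 z.2)) ∈ (capUp : Set (𝕊 (n + 1))) :=
    fun z => hρ1 _ (hHc''q _)
  have hcD : eqUp n ⊆ upMinus p := eqUp_subset_upMinus hp
  have hmid : Homotopic (widen hcD f'ℓ) (widen hcD (RelGenLoop.const s (eqUp n) a)) := by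
    refine homotopic_of_stages ⟨fun z => ⟨ρLo q (1, Hc'' (enc z.1 z.2)), hK₂up z⟩, hK₂c.subtype_mk _⟩
      (fun y => Subtype.ext ?_) (fun y => Subtype.ext ?_) (fun t y hy => ?_) (fun t y hy => Subtype.ext ?_)
    · show ρLo q (1, Hc'' (enc 0 y)) = H₂ (1, enc 0 y)
      rw [hnone_wall 0 y (Or.inl rfl)]
      exact hρC 1 _ (hf'up y)
    · show ρLo q (1, Hc'' (enc 1 y)) = ((a : Up n) : 𝕊 (n + 1))
      rw [hnone_wall 1 y (Or.inr rfl), show Hc' (enc 1 y) = (base : 𝕊 (n + 1)) from keepBase 1 _ (hHc1 y)]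
      exact hρC 1 _ (mem_capUp_iff.2 hbase0.ge)
    · show ρLo q (1, Hc'' (enc t y)) ≠ p
      exact ρLo_ne_of_ne hp hq 1 (hGfloor 1 _ (by simpa using hy))
    · show ρLo q (1, Hc'' (enc t y)) = ((a : Up n) : 𝕊 (n + 1))
      rw [hHc''J t y hy]
      exact hρC 1 _ (mem_capUp_iff.2 hbase0.ge)
  -- Step 4: down the collar `C₊ - p ↝ Sⁿ`
  obtain ⟨hAc, hAD, hA0, hA1, hAC⟩ := ρA_collar (n := n) hp
  exact hff'.trans (RelGenLoop.homotopic_of_homotopic_widen s hAc hAD hA0 hA1 hAC hcD a hmid)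

end Injectivity

end HemisphereExcision

end Literature.AlgebraicTopology.Homotopy
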